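import Literature.Probability.Process.LocalRubberHardCore
import Mathlib.Topology.MetricSpace.Closeds
import Mathlib.Topology.MetricSpace.ProperSpace
import HarnessLib

/-!
# Compactness of the local rubber topology (Baake–Lenz Thm 3 / Lenz–Stollmann Thm 1.2)

Topic: `Literature/Probability/Process`. Sequel of `LocalRubberMetric.lean`,
`LocalRubberHardCore.lean` (definition request `defn-LocallyMatches`, part (2): "compact metrisable
for `δ > 0`").

* `LocalConfig.instCompactSpace` — for a PROPER normed group `E` (e.g. `ℝᵈ`) the space
  `LocalConfig E` of all point configurations with the local rubber (pseudo)metric is COMPACT: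
  every sequence of configurations has a locally convergent subsequence. This is
  [BaakeLenz2004, §4 Thm 3] (closed subsets of a σ-compact LCA group, uniformity proof) and
  [LenzStollmann2002, §1 Thm 1.2] (closed subsets of `ℝᵈ`), whose proof we follow: the closed
  traces `closure (S ∩ B̄(0, k))` live in the hyperspace of closed subsets of the compact ball
  `B̄(0, k)` with the Hausdorff distance, which is compact (Mathlib: `Closeds.compactSpace`); one
  diagonal subsequence (here: sequential compactness of the countable product) makes all traces
  converge, to `Λ_k` say, and `C = ⋃ₖ Λ_k` is the local limit, because `C ∩ B(0, k) ⊆ Λ_k ⊆ C`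
  (`mem_limitTrace_of_norm_lt`). No separation or closedness hypothesis is needed
  (Lenz–Stollmann: "interestingly, no additional properties are needed for compactness").
* `LocalConfig.isCompact_setOf_rooted_separated` — consequently, for `δ > 0` the rooted
  `δ`-hard-core configurations `{S | 0 ∈ S ∧ S δ-separated}` (the carrier of the laws in
  `IsRootedHardCore δ`, `isRootedHardCore_toMeasure_iff`) form a COMPACT set
  [BaakeLenz2004, §4 Prop. 4]; with `LocalConfig.instPseudoMetricSpace` this is the "compact
  metrisable space of rooted hard-core configurations" on which Benjamini–Schramm limits of finite
  configurations seen from a typical point are extracted (Prokhorov).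
* `LocalConfig.eq_of_isClosed_of_dist_eq_zero` — on CLOSED configurations the rubber pseudometric
  is a metric (Baake–Lenz Thm 3: the LRT is Hausdorff).

## References
* M. Baake, D. Lenz, Ergodic Theory Dynam. Systems 24 (2004), §4 Thm 3, Prop. 4. [BaakeLenz2004]
* D. Lenz, P. Stollmann, *Delone dynamical systems and associated random operators* (2003),
  arXiv:math-ph/0202042, §1 Thm 1.2 (proof via Hausdorff metric on `𝒦(B_{k+1/2})` and a diagonal
  argument). [LenzStollmann2002]
-/

noncomputable section

open _root_.MeasureTheory Set Filter Metric TopologicalSpace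
open scoped _root_.Topology ENNReal

namespace Literature.Probability.Process

namespace LocalConfig

section Closeds

variable {E : Type*} [EMetricSpace E]

/-- The closed subsets of a compact set `K` form a compact subset of the hyperspace `Closeds E`
(Hausdorff edistance): it is the isometric image of the compact hyperspace `Closeds K`.
[folklore] -/
theorem isCompact_setOf_closeds_subset {K : Set E} (hK : IsCompact K) :
    IsCompact {F : Closeds E | (F : Set E) ⊆ K} := by
  haveI : CompactSpace K := isCompact_iff_compactSpace.1 hK
  have hKc : IsClosed K := hK.isClosed
  -- the isometric push-forward `Closeds K → Closeds E`
  let Φ : Closeds K → Closeds E := fun F =>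
    ⟨((↑) : K → E) '' (F : Set K), (hKc.isClosedEmbedding_subtypeVal.isClosedMap _ F.isClosed)⟩
  have hΦ : Isometry Φ := fun F G => by
    rw [Closeds.edist_eq, Closeds.edist_eq]
    exact hausdorffEDist_image isometry_subtype_coe
  have hrange : {F : Closeds E | (F : Set E) ⊆ K} = range Φ := by
    ext F
    constructor
    · intro hF
      refine ⟨⟨((↑) : K → E) ⁻¹' (F : Set E), F.isClosed.preimage continuous_subtype_val⟩, ?_⟩
      ext x
      simp only [Φ, Closeds.coe_mk, mem_image, mem_preimage, Subtype.exists, exists_and_right,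
        exists_eq_right, SetLike.mem_coe]
      exact ⟨fun ⟨_, h⟩ => h, fun h => ⟨hF h, h⟩⟩
    · rintro ⟨G, rfl⟩
      rintro _ ⟨x, -, rfl⟩
      exact x.2
  rw [hrange]
  exact isCompact_range hΦ.continuous

end Closeds

section Compact

variable {E : Type*} [NormedAddCommGroup E]

/-- The closed trace of a configuration on the ball `B̄(0, k)`, as a point of the hyperspace
`Closeds E`. [folklore] -/
def closedTrace (k : ℕ) (S : Set E) : Closeds E :=
  ⟨closure (S ∩ closedBall (0 : E) k), isClosed_closure⟩

/-- The closed trace on `B̄(0, k)` is contained in `B̄(0, k)`. [folklore] -/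
theorem coe_closedTrace_subset (k : ℕ) (S : Set E) :
    (closedTrace k S : Set E) ⊆ closedBall (0 : E) k :=
  closure_minimal inter_subset_right isClosed_closedBall

/-- Points of the configuration in `B̄(0, k)` lie in the closed trace. [folklore] -/
theorem mem_closedTrace {k : ℕ} {S : Set E} {x : E} (hx : x ∈ S) (hxk : ‖x‖ ≤ k) :
    x ∈ (closedTrace k S : Set E) :=
  subset_closure ⟨hx, mem_closedBall_zero_iff.2 hxk⟩

/-- Points of the closed trace are approximated by points of `S ∩ B̄(0, k)`. [folklore] -/
theorem exists_mem_of_mem_closedTrace {k : ℕ} {S : Set E} {x : E}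
    (hx : x ∈ (closedTrace k S : Set E)) {η : ℝ} (hη : 0 < η) :
    ∃ y ∈ S, ‖y‖ ≤ k ∧ dist x y < η := by
  obtain ⟨y, ⟨hyS, hyk⟩, hxy⟩ := Metric.mem_closure_iff.1 hx η hη
  exact ⟨y, hyS, mem_closedBall_zero_iff.1 hyk, hxy⟩

/-- **Diagonal extraction** (the heart of Lenz–Stollmann Thm 1.2): every sequence of
configurations has a subsequence along which, for EVERY `k`, the closed traces on `B̄(0, k)`
converge in Hausdorff edistance to closed sets `Λ k ⊆ B̄(0, k)`. (Sequential compactness of the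
countable product of the compact hyperspaces `{F : Closeds E | F ⊆ B̄(0, k)}`.)
[cite: LenzStollmann2002, §1 Thm 1.2 (proof)] -/
theorem exists_subseq_tendsto_closedTrace [ProperSpace E] (u : ℕ → Set E) :
    ∃ Λ : ℕ → Closeds E, ∃ φ : ℕ → ℕ, StrictMono φ ∧ (∀ k, (Λ k : Set E) ⊆ closedBall (0 : E) k) ∧
      ∀ k, ∀ η : ℝ, 0 < η → ∀ᶠ j in atTop,
        hausdorffEDist (closedTrace k (u (φ j)) : Set E) (Λ k) < ENNReal.ofReal η := by
  have hK : ∀ k : ℕ, IsCompact {F : Closeds E | (F : Set E) ⊆ closedBall (0 : E) k} := fun k =>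
    isCompact_setOf_closeds_subset (isCompact_closedBall _ _)
  haveI : ∀ k : ℕ, CompactSpace {F : Closeds E // (F : Set E) ⊆ closedBall (0 : E) k} := fun k =>
    isCompact_iff_compactSpace.1 (hK k)
  let x : ℕ → ∀ k : ℕ, {F : Closeds E // (F : Set E) ⊆ closedBall (0 : E) k} := fun j k =>
    ⟨closedTrace k (u j), coe_closedTrace_subset k (u j)⟩
  obtain ⟨L, φ, hφ, hL⟩ := CompactSpace.tendsto_subseq x
  refine ⟨fun k => (L k : Closeds E), φ, hφ, fun k => (L k).2, fun k η hη => ?_⟩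
  have hk : Tendsto (fun j => (x (φ j) k : Closeds E)) atTop (𝓝 (L k : Closeds E)) :=
    tendsto_subtype_rng.1 ((tendsto_pi_nhds.1 hL) k)
  have := (EMetric.tendsto_nhds.1 hk) (ENNReal.ofReal η) (by simpa using hη)
  filter_upwards [this] with j hj
  rwa [Closeds.edist_eq] at hj

/-- The local limit candidate: the union of the limit traces. [folklore] -/
def limitTrace (Λ : ℕ → Closeds E) : Set E :=
  ⋃ k, (Λ k : Set E)

/-- **Consistency of the limit traces** (`C ∩ B(0,k) ⊆ Λ_k`, Lenz–Stollmann's `(*)`): along a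
subsequence as in `exists_subseq_tendsto_closedTrace`, a point of ANY limit trace of norm `< k`
belongs to the `k`-th limit trace. (It is approximated by configuration points of norm `< k`,
which lie in the `k`-traces, which converge to `Λ k`; `Λ k` is closed.)
[cite: LenzStollmann2002, §1 Thm 1.2 (proof, (*))] -/
theorem mem_limitTrace_of_norm_lt {v : ℕ → Set E} {Λ : ℕ → Closeds E}
    (hΛ : ∀ k, ∀ η : ℝ, 0 < η → ∀ᶠ j in atTop,
      hausdorffEDist (closedTrace k (v j) : Set E) (Λ k) < ENNReal.ofReal η)
    {k : ℕ} {q : E} (hq : q ∈ limitTrace Λ) (hqk : ‖q‖ < k) : q ∈ (Λ k : Set E) := by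
  obtain ⟨m, hqm⟩ := mem_iUnion.1 hq
  -- `infEdist q (Λ k) ≤ 3η` for every small `η > 0`
  have key : ∀ η : ℝ, 0 < η → 2 * η ≤ k - ‖q‖ →
      infEDist q (Λ k : Set E) ≤ ENNReal.ofReal (3 * η) := fun η hη hηk => by
    obtain ⟨j, hjm, hjk⟩ := ((hΛ m η hη).and (hΛ k η hη)).exists
    -- a point of the `m`-trace near `q`, then a configuration point near it
    obtain ⟨a, ha, hqa⟩ := exists_edist_lt_of_hausdorffEDist_lt hqm
      (by rwa [hausdorffEDist_comm] at hjm)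
    rw [edist_lt_ofReal] at hqa
    obtain ⟨a', ha'S, -, haa'⟩ := exists_mem_of_mem_closedTrace ha hη
    have hqa' : dist q a' < 2 * η := by
      have := dist_triangle q a a'
      linarith
    have ha'k : ‖a'‖ ≤ k := by
      have h1 : ‖a'‖ ≤ ‖q‖ + dist q a' := by
        have := dist_triangle a' q 0
        rw [dist_zero_right, dist_zero_right, dist_comm] at this
        linarith
      linarith
    have ha'tr : a' ∈ (closedTrace k (v j) : Set E) := mem_closedTrace ha'S ha'k
    calc infEDist q (Λ k : Set E)
        ≤ infEDist q (closedTrace k (v j) : Set E) +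
            hausdorffEDist (closedTrace k (v j) : Set E) (Λ k) :=
          infEDist_le_infEDist_add_hausdorffEDist
      _ ≤ ENNReal.ofReal (2 * η) + ENNReal.ofReal η := by
          refine add_le_add ?_ hjk.le
          refine (infEDist_le_edist_of_mem ha'tr).trans ?_
          rw [edist_dist]
          exact ENNReal.ofReal_le_ofReal hqa'.le
      _ = ENNReal.ofReal (3 * η) := by
          rw [← ENNReal.ofReal_add (by linarith) hη.le]
          ring_nf
  have h0 : infEDist q (Λ k : Set E) = 0 := by
    refine le_antisymm (ENNReal.le_of_forall_pos_le_add fun ε hε _ => ?_) zero_le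
    rw [zero_add]
    have hgap : 0 < (k : ℝ) - ‖q‖ := by linarith
    set η := min ((ε : ℝ) / 3) ((k - ‖q‖) / 2) with hη_def
    have hη : 0 < η := lt_min (by positivity) (by positivity)
    have hηk : 2 * η ≤ k - ‖q‖ := by
      have := min_le_right ((ε : ℝ) / 3) ((k - ‖q‖) / 2)
      linarith
    refine (key η hη hηk).trans ?_
    have h3 : 3 * η ≤ ε := by
      have := min_le_left ((ε : ℝ) / 3) ((k - ‖q‖) / 2)
      linarith
    calc ENNReal.ofReal (3 * η) ≤ ENNReal.ofReal (ε : ℝ) := ENNReal.ofReal_le_ofReal h3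
      _ = ε := ENNReal.ofReal_coe_nnreal
  have := mem_closure_iff_infEDist_zero.2 h0
  rwa [(Λ k).isClosed.closure_eq] at this

/-- **Local convergence to the union of the limit traces**: along a subsequence as in
`exists_subseq_tendsto_closedTrace`, the configurations converge in the local rubber topology to
`C = ⋃ₖ Λ_k`. [cite: LenzStollmann2002, §1 Thm 1.2 (proof)] -/
theorem tendsto_limitTrace {v : ℕ → Set E} {Λ : ℕ → Closeds E}
    (hΛ : ∀ k, ∀ η : ℝ, 0 < η → ∀ᶠ j in atTop,
      hausdorffEDist (closedTrace k (v j) : Set E) (Λ k) < ENNReal.ofReal η) :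
    Tendsto (fun j => (LocalConfig.mk (v j) : LocalConfig E)) atTop
      (𝓝 (LocalConfig.mk (limitTrace Λ))) := by
  rw [tendsto_iff_locallyMatches]
  simp only [coe_mk]
  intro R ε hε
  obtain ⟨k, hk⟩ := exists_nat_gt R
  filter_upwards [hΛ k (ε / 2) (half_pos hε)] with j hj
  refine ⟨fun p hp hpR => ?_, fun q hq hqR => ?_⟩
  · -- a configuration point `p` in the ball: in the `k`-trace, hence near `Λ k ⊆ C`
    have hptr : p ∈ (closedTrace k (v j) : Set E) := mem_closedTrace hp (by linarith)
    obtain ⟨c, hc, hpc⟩ := exists_edist_lt_of_hausdorffEDist_lt hptr hj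
    rw [edist_lt_ofReal] at hpc
    refine ⟨c, mem_iUnion.2 ⟨k, hc⟩, ?_⟩
    rw [dist_comm]
    linarith
  · -- a limit point `q` in the ball: in `Λ k`, hence near the `k`-trace, hence near `v j`
    have hqk : q ∈ (Λ k : Set E) := mem_limitTrace_of_norm_lt hΛ hq (by linarith)
    obtain ⟨a, ha, hqa⟩ := exists_edist_lt_of_hausdorffEDist_lt hqk
      (by rwa [hausdorffEDist_comm] at hj)
    rw [edist_lt_ofReal] at hqa
    obtain ⟨a', ha'S, -, haa'⟩ := exists_mem_of_mem_closedTrace ha (half_pos hε)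
    refine ⟨a', ha'S, ?_⟩
    have := dist_triangle q a a'
    linarith

/-- **Compactness of the local rubber topology** (Baake–Lenz Thm 3; Lenz–Stollmann Thm 1.2): for a
proper normed group `E`, every sequence of point configurations of `E` has a subsequence
converging in the local rubber topology; `LocalConfig E` is a compact pseudometric space.
[cite: BaakeLenz2004, §4 Thm 3] -/
theorem exists_tendsto_subseq [ProperSpace E] (u : ℕ → LocalConfig E) :
    ∃ C : LocalConfig E, ∃ φ : ℕ → ℕ, StrictMono φ ∧ Tendsto (u ∘ φ) atTop (𝓝 C) := by
  obtain ⟨Λ, φ, hφ, -, hΛ⟩ :=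
    exists_subseq_tendsto_closedTrace (E := E) (fun j => ((u j : LocalConfig E) : Set E))
  refine ⟨LocalConfig.mk (limitTrace Λ), φ, hφ, ?_⟩
  have h : Tendsto (fun j => (LocalConfig.mk ((u (φ j) : LocalConfig E) : Set E) : LocalConfig E))
      atTop (𝓝 (LocalConfig.mk (limitTrace Λ))) :=
    tendsto_limitTrace (v := fun j => ((u (φ j) : LocalConfig E) : Set E)) hΛ
  refine h.congr fun j => ?_
  show LocalConfig.mk ((u (φ j) : LocalConfig E) : Set E) = u (φ j)
  exact mk_coe (u (φ j))

/-- **`LocalConfig E` is compact** for proper `E` (Baake–Lenz Thm 3 / Lenz–Stollmann Thm 1.2).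
[cite: BaakeLenz2004, §4 Thm 3] -/
instance instCompactSpace [ProperSpace E] : CompactSpace (LocalConfig E) := by
  refine compactSpace_iff_seqCompactSpace.2 ⟨fun u _ => ?_⟩
  obtain ⟨C, φ, hφ, h⟩ := exists_tendsto_subseq u
  exact ⟨C, mem_univ _, φ, hφ, h⟩

end Compact

section HardCoreCompact

variable {E : Type*} [NormedAddCommGroup E] [ProperSpace E]

/-- **The rooted `δ`-hard-core configurations form a compact set** of the local rubber topology
(`δ > 0`): closed (`isClosed_setOf_rooted_separated`) in the compact space `LocalConfig E`.
This is the compact (pseudo)metrisable space of rooted hard-core configurations of the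
Benjamini–Schramm construction (Baake–Lenz Prop. 4: `𝒟_V` compact in the LRT).
[cite: BaakeLenz2004, §4 Prop. 4] -/
theorem isCompact_setOf_rooted_separated {δ : ℝ} (hδ : 0 < δ) :
    IsCompact {S : LocalConfig E | (0 : E) ∈ S ∧ ∀ x ∈ S, ∀ y ∈ S, x ≠ y → δ ≤ dist x y} :=
  (isClosed_setOf_rooted_separated hδ).isCompact

/-- The `δ`-separated configurations form a compact set (`δ` arbitrary; for `δ ≤ 0` this is all
of `LocalConfig E`). [cite: BaakeLenz2004, §4 Prop. 4] -/
theorem isCompact_setOf_separated (δ : ℝ) :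
    IsCompact {S : LocalConfig E | ∀ x ∈ S, ∀ y ∈ S, x ≠ y → δ ≤ dist x y} :=
  (isClosed_setOf_separated δ).isCompact

end HardCoreCompact

section Closed

variable {E : Type*} [SeminormedAddCommGroup E]

/-- A configuration at rubber distance `0` from `T` lies in the closure of `T`. [folklore] -/
theorem subset_closure_of_dist_eq_zero {S T : LocalConfig E} (h : dist S T = 0) :
    (S : Set E) ⊆ closure (T : Set E) := by
  intro q hq
  rw [Metric.mem_closure_iff]
  intro η hη
  obtain ⟨θ, hθ, hθS⟩ := exists_dist_lt_locallyMatches (E := E) ‖q‖ (half_pos hη)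
  obtain ⟨p, hp, hqp⟩ := (hθS S T (by rw [h]; exact hθ)).2 q hq le_rfl
  exact ⟨p, hp, by linarith⟩

/-- **On closed configurations the rubber pseudometric is a metric** (the local rubber topology
is Hausdorff, Baake–Lenz Thm 3): closed configurations at distance `0` are equal.
[cite: BaakeLenz2004, §4 Thm 3] -/
theorem eq_of_isClosed_of_dist_eq_zero {S T : LocalConfig E} (hS : IsClosed (S : Set E))
    (hT : IsClosed (T : Set E)) (h : dist S T = 0) : S = T := by
  refine SetLike.coe_injective (Subset.antisymm ?_ ?_)
  · simpa only [hT.closure_eq] using subset_closure_of_dist_eq_zero h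
  · simpa only [hS.closure_eq] using
      subset_closure_of_dist_eq_zero (S := T) (T := S) (by rwa [dist_comm])

/-- Every configuration is at rubber distance `0` from its closure (the pseudometric identifies
exactly a set and its closure). [folklore] -/
theorem dist_closure_eq_zero (S : LocalConfig E) :
    dist S (LocalConfig.mk (closure (S : Set E))) = 0 := by
  refine le_antisymm (le_of_forall_pos_lt_add fun η hη => ?_) dist_nonneg
  rw [zero_add]
  have hm : LocallyMatches (min (η / 2) 1)⁻¹ (min (η / 2) 1) (S : Set E) (closure (S : Set E)) := by
    refine ⟨fun p hp _ => ?_, fun q hq _ => ⟨q, subset_closure hq, ?_⟩⟩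
    · obtain ⟨q, hq, hpq⟩ := Metric.mem_closure_iff.1 hp _ (lt_min (half_pos hη) one_pos)
      exact ⟨q, hq, by rw [dist_comm]; exact hpq.le⟩
    · rw [dist_self]
      exact (lt_min (half_pos hη) one_pos).le
  have := dist_le_of_locallyMatches (S := S) (T := LocalConfig.mk (closure (S : Set E)))
    (lt_min (half_pos hη) one_pos) hm
  have h2 : min (η / 2) 1 ≤ η / 2 := min_le_left _ _
  linarith

end Closed

end LocalConfig

end Literature.Probability.Process
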